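import Summits.QuantumFields.YangMills.Theses.RandomConstraintAnnealing
import Summits.QuantumFields.YangMills.Theses.DirichletWindow
import Summits.QuantumFields.YangMills.Theorems.EquipartitionCriticalityCriticalContinuumLimitStubLatticeGap
import Summits.QuantumFields.YangMills.Theorems.EquipartitionCriticalityCriticalContinuumLimitStubOneFieldExtension
import Summits.QuantumFields.YangMills.Theorems.EquipartitionCriticalityFreeEnergyLogCoefficient
import Summits.QuantumFields.YangMills.Theorems.EquipartitionCriticalityEquipartitionPinsProbe
import Summits.QuantumFields.YangMills.Theorems.EquipartitionCriticalityRPProbeCriticality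
import Literature.MathematicalPhysics.QuantumFieldTheory.GaugeOSData

/-! VARIANT B: the three children as closed Props in route spelling, their `Iff.rfl` identity with the hub's
birth-stub statements, and the sorry-free assembly `latticeGapToClay_of_variantB`. -/

noncomputable section

open scoped SchwartzMap
open MeasureTheory Filter Topology
open Literature.MathematicalPhysics.AQFT Literature.MathematicalPhysics.QuantumLattice
open Literature.MathematicalPhysics.QuantumFieldTheory
open Summit.QuantumFields.YangMills.Theorems.HypercubicLimit.Negative (onlySpecies)

namespace Summit.QuantumFields.YangMills.Cruxes.LatticeGapToClay.VariantB

open Summit.QuantumFields.YangMills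

/-- variant B child `RateSaturation` (route spelling) -/
def RateSaturation : Prop :=
  ∀ (G : Type) [Group G] [TopologicalSpace G] [IsTopologicalGroup G] [CompactSpace G] [MeasurableSpace G] [BorelSpace G] (hG : Literature.MathematicalPhysics.QuantumFieldTheory.IsCompactSimpleLieGroup G) (r : Literature.MathematicalPhysics.QuantumFieldTheory.LatticeRep G) (β₁ : ℝ) (m : ℝ → ℝ) (S₀ : ℝ → ℕ) (hpos : ∀ β : ℝ, β₁ ≤ β → 0 < m β) (hdec : ∀ A B : Literature.MathematicalPhysics.QuantumFieldTheory.YMSpecies G, ∃ C : ℝ, ∀ β : ℝ, β₁ ≤ β → ∀ S n : ℕ, S₀ β ≤ S → n ≤ S → |Literature.MathematicalPhysics.QuantumFieldTheory.latticeConnectedCorr r.ρ β (2 * S + 1) A.F B.F n| ≤ C * Real.exp (-(m β * n))) (H2 : ∀ (β₂ : ℝ) (m₂ : ℝ → ℝ), (∀ β : ℝ, β₂ ≤ β → 0 < m₂ β ∧ (∃ S₂ : ℕ, ∀ A B : Literature.MathematicalPhysics.QuantumFieldTheory.YMSpecies G, ∃ C : ℝ, ∀ S n : ℕ, S₂ ≤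 S → n ≤ S → |Literature.MathematicalPhysics.QuantumFieldTheory.latticeConnectedCorr r.ρ β (2 * S + 1) A.F B.F n| ≤ C * Real.exp (-(m₂ β * n)))) → ∀ m₀ : ℝ, 0 < m₀ → ∀ᶠ β : ℝ in Filter.atTop, m₂ β < m₀), ∃ (βs : ℝ) (ms : ℝ → ℝ) (Ss : ℝ → ℕ), (∀ β : ℝ, βs ≤ β → 0 < ms β) ∧ (∀ A B : Literature.MathematicalPhysics.QuantumFieldTheory.YMSpecies G, ∃ C : ℝ, ∀ β : ℝ, βs ≤ β → ∀ S n : ℕ, Ss β ≤ S → n ≤ S → |Literature.MathematicalPhysics.QuantumFieldTheory.latticeConnectedCorr r.ρ β (2 * S + 1) A.F B.F n| ≤ C * Real.exp (-(ms β * n))) ∧ ∃ C₀ : ℝ, 0 < C₀ ∧ ∃ᶠ β : ℝ in Filter.atTop, ∀ κ : ℝ, 0 < κ → ∃ w : ℝ, 0 < w ∧ ∃ᶠ S : ℕ in Filter.atTop, ∀ n : ℕ, (n : ℝ) * ms β ≤ κ → w * Real.exp (-(C₀ * (ms β * n))) ≤ Literature.MathematicalPhysics.QuantumFieldTheory.latticeConnectedCorr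 r.ρ β (2 * S + 1) (r.curvature.F ∘ fun (U : Literature.MathematicalPhysics.QuantumLattice.LGConfig 4 G) (e : (Fin 4 → ℤ) × Fin 4) => if e.2 = 0 then (U (Function.update (e.1 + Pi.single 0 1 : Fin 4 → ℤ) 0 (-1 - (e.1 + Pi.single 0 1 : Fin 4 → ℤ) 0), 0))⁻¹ else U (Function.update e.1 0 (-1 - e.1 0), e.2)) r.curvature.F n

/-- variant B child `ContinuumLimitOS` (route spelling) -/
def ContinuumLimitOS : Prop :=
  ∀ (G : Type) [Group G] [TopologicalSpace G] [IsTopologicalGroup G] [CompactSpace G] [MeasurableSpace G] [BorelSpace G] (r : Literature.MathematicalPhysics.QuantumFieldTheory.LatticeRep G) (βs : ℝ) (ms : ℝ → ℝ) (Ss : ℝ → ℕ) (hpos : ∀ β : ℝ, βs ≤ β → 0 < ms β) (hdec : ∀ A B : Literature.MathematicalPhysics.QuantumFieldTheory.YMSpecies G, ∃ C : ℝ, ∀ β : ℝ, βs ≤ β → ∀ S n : ℕ, Ss β ≤ S → n ≤ S → |Literature.MathematicalPhysics.QuantumFieldTheory.latticeConnectedCorr r.ρ β (2 * S + 1) A.F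 B.F n| ≤ C * Real.exp (-(ms β * n))) (hcrit : ∀ m₀ : ℝ, 0 < m₀ → ∀ᶠ β : ℝ in Filter.atTop, ms β < m₀) (hP : ∃ C₀ : ℝ, 0 < C₀ ∧ ∃ᶠ β : ℝ in Filter.atTop, ∀ κ : ℝ, 0 < κ → ∃ w : ℝ, 0 < w ∧ ∃ᶠ S : ℕ in Filter.atTop, ∀ n : ℕ, (n : ℝ) * ms β ≤ κ → w * Real.exp (-(C₀ * (ms β * n))) ≤ Literature.MathematicalPhysics.QuantumFieldTheory.latticeConnectedCorr r.ρ β (2 * S + 1) (r.curvature.F ∘ fun (U : Literature.MathematicalPhysics.QuantumLattice.LGConfig 4 G) (e : (Fin 4 → ℤ) × Fin 4) => if e.2 = 0 then (U (Function.update (e.1 + Pi.single 0 1 : Fin 4 → ℤ) 0 (-1 - (e.1 + Pi.single 0 1 : Fin 4 → ℤ) 0), 0))⁻¹ else U (Function.update e.1 0 (-1 - e.1 0), e.2)) r.curvature.F n), ∃ (Δ : ℝ) (sch : Literature.MathematicalPhysics.QuantumFieldTheory.SpeciesScheme (Literature.MathematicalPhysics.QuantumFieldTheory.YMSpecies G))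 (S₁ : Literature.MathematicalPhysics.QuantumLattice.SchwingerFamily (EuclideanSpace ℝ (Fin 4))), 0 < Δ ∧ Filter.Tendsto sch.β Filter.atTop Filter.atTop ∧ (∀ᶠ k in Filter.atTop, βs ≤ sch.β k) ∧ (∀ k, sch.a k = ms (sch.β k) / Δ) ∧ (∀ᶠ k in Filter.atTop, Ss (sch.β k) ≤ sch.L k) ∧ Literature.MathematicalPhysics.AQFT.OSAxiomsSchwinger S₁.toLabelled ∧ (∀ (n : ℕ), n ≠ 0 → ∀ (f : Fin n → SchwartzMap (EuclideanSpace ℝ (Fin 4)) ℝ) (F : SchwartzMap (Fin n → EuclideanSpace ℝ (Fin 4)) ℂ), Literature.MathematicalPhysics.QuantumLattice.IsTensorOf F (fun i => Literature.MathematicalPhysics.QuantumLattice.ofRealTest (f i)) → Literature.MathematicalPhysics.AQFT.IsOffDiagonal F → Filter.Tendsto (fun k : ℕ => ((Literature.MathematicalPhysics.QuantumFieldTheory.latticeSchwinger r.ρ sch (fun s => s.F) k n (fun _ => r.curvature) f : ℝ) : ℂ)) Filter.atTop (nhds (S₁ n F))) ∧ (∃ (F₁ G₁ : SchwartzMap (Fin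 1 → EuclideanSpace ℝ (Fin 4)) ℂ) (H₁ : SchwartzMap (Fin (1 + 1) → EuclideanSpace ℝ (Fin 4)) ℂ), Literature.MathematicalPhysics.QuantumLattice.IsTimeOrdered F₁ ∧ Literature.MathematicalPhysics.QuantumLattice.IsTimeOrdered G₁ ∧ Literature.MathematicalPhysics.QuantumLattice.IsAppendTensorOf H₁ (Literature.MathematicalPhysics.QuantumLattice.osAdjoint F₁) G₁ ∧ S₁ (1 + 1) H₁ ≠ S₁ 1 (Literature.MathematicalPhysics.QuantumLattice.osAdjoint F₁) * S₁ 1 G₁) ∧ S₁.toLabelled.HasMassGap Δ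

/-- variant B child `NonGaussianLimit` (route spelling) -/
def NonGaussianLimit : Prop :=
  ∀ (G : Type) [Group G] [TopologicalSpace G] [IsTopologicalGroup G] [CompactSpace G] [MeasurableSpace G] [BorelSpace G] (hG : Literature.MathematicalPhysics.QuantumFieldTheory.IsCompactSimpleLieGroup G) (r : Literature.MathematicalPhysics.QuantumFieldTheory.LatticeRep G) (βs : ℝ) (ms : ℝ → ℝ) (Ss : ℝ → ℕ) (hpos : ∀ β : ℝ, βs ≤ β → 0 < ms β) (hdec : ∀ A B : Literature.MathematicalPhysics.QuantumFieldTheory.YMSpecies G, ∃ C : ℝ, ∀ β : ℝ, βs ≤ β → ∀ S n : ℕ, Ss β ≤ S → n ≤ S → |Literature.MathematicalPhysics.QuantumFieldTheory.latticeConnectedCorr r.ρ β (2 * S + 1) A.F B.F n| ≤ C * Real.exp (-(ms β * n))) (Δ : ℝ) (hΔ : 0 < Δ) (sch : Literature.MathematicalPhysics.QuantumFieldTheory.SpeciesScheme (Literature.MathematicalPhysics.QuantumFieldTheory.YMSpecies G)) (hride : Filter.Tendsto sch.β Filter.atTop Filter.atTop ∧ (∀ᶠ k in Filter.atTop, βs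 ≤ sch.β k) ∧ (∀ k, sch.a k = ms (sch.β k) / Δ) ∧ (∀ᶠ k in Filter.atTop, Ss (sch.β k) ≤ sch.L k)) (S₁ : Literature.MathematicalPhysics.QuantumLattice.SchwingerFamily (EuclideanSpace ℝ (Fin 4))) (hOS : Literature.MathematicalPhysics.AQFT.OSAxiomsSchwinger S₁.toLabelled) (hconv : ∀ (n : ℕ), n ≠ 0 → ∀ (f : Fin n → SchwartzMap (EuclideanSpace ℝ (Fin 4)) ℝ) (F : SchwartzMap (Fin n → EuclideanSpace ℝ (Fin 4)) ℂ), Literature.MathematicalPhysics.QuantumLattice.IsTensorOf F (fun i => Literature.MathematicalPhysics.QuantumLattice.ofRealTest (f i)) → Literature.MathematicalPhysics.AQFT.IsOffDiagonal F → Filter.Tendsto (fun k : ℕ => ((Literature.MathematicalPhysics.QuantumFieldTheory.latticeSchwinger r.ρ sch (fun s => s.F) k n (fun _ => r.curvature) f : ℝ) : ℂ)) Filter.atTop (nhds (S₁ n F))) (hnt : ∃ (F₁ G₁ : SchwartzMap (Fin 1 → EuclideanSpace ℝ (Fin 4)) ℂ) (H₁ : SchwartzMap (Fin (1 + 1) →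 EuclideanSpace ℝ (Fin 4)) ℂ), Literature.MathematicalPhysics.QuantumLattice.IsTimeOrdered F₁ ∧ Literature.MathematicalPhysics.QuantumLattice.IsTimeOrdered G₁ ∧ Literature.MathematicalPhysics.QuantumLattice.IsAppendTensorOf H₁ (Literature.MathematicalPhysics.QuantumLattice.osAdjoint F₁) G₁ ∧ S₁ (1 + 1) H₁ ≠ S₁ 1 (Literature.MathematicalPhysics.QuantumLattice.osAdjoint F₁) * S₁ 1 G₁) (hgap : S₁.toLabelled.HasMassGap Δ), ∃ (f g h : SchwartzMap (EuclideanSpace ℝ (Fin 4)) ℂ) (Ffgh : SchwartzMap (Fin 3 → EuclideanSpace ℝ (Fin 4)) ℂ) (Fgh Ffh Ffg : SchwartzMap (Fin 2 → EuclideanSpace ℝ (Fin 4)) ℂ) (Ff Fg Fh : SchwartzMap (Fin 1 → EuclideanSpace ℝ (Fin 4)) ℂ), Literature.MathematicalPhysics.QuantumLattice.IsTensorOf Ffgh ![f, g, h] ∧ Literature.MathematicalPhysics.AQFT.IsOffDiagonal Ffgh ∧ Literature.MathematicalPhysics.QuantumLattice.IsTensorOf Fgh ![g, h] ∧ Literature.MathematicalPhysics.QuantumLattice.IsTensorOf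 Ffh ![f, h] ∧ Literature.MathematicalPhysics.QuantumLattice.IsTensorOf Ffg ![f, g] ∧ Literature.MathematicalPhysics.QuantumLattice.IsTensorOf Ff ![f] ∧ Literature.MathematicalPhysics.QuantumLattice.IsTensorOf Fg ![g] ∧ Literature.MathematicalPhysics.QuantumLattice.IsTensorOf Fh ![h] ∧ S₁ 3 Ffgh - S₁ 1 Ff * S₁ 2 Fgh - S₁ 1 Fg * S₁ 2 Ffh - S₁ 1 Fh * S₁ 2 Ffg + 2 * (S₁ 1 Ff * S₁ 1 Fg * S₁ 1 Fh) ≠ 0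

/-- Weak-coupling criticality (Chatterjee 5.1(b)) as a tree theorem — the hub's hypothesis (2). [cite: arXiv180301950, Problem 5.1(b)] -/
theorem weakCouplingCriticality' :
    ∀ (G : Type) [Group G] [TopologicalSpace G] [IsTopologicalGroup G] [CompactSpace G],
      IsCompactSimpleLieGroup G →
        letI : MeasurableSpace G := borel G
        haveI : BorelSpace G := ⟨rfl⟩
        ∀ r : LatticeRep G, ∀ (β₁ : ℝ) (m : ℝ → ℝ),
          (∀ β : ℝ, β₁ ≤ β → 0 < m β ∧ (∃ S₀ : ℕ, ∀ A B : YMSpecies G, ∃ C : ℝ, ∀ S n : ℕ,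
              S₀ ≤ S → n ≤ S →
                |latticeConnectedCorr r.ρ β (2 * S + 1) A.F B.F n| ≤ C * Real.exp (-(m β * n)))) →
            ∀ m₀ : ℝ, 0 < m₀ → ∀ᶠ β : ℝ in Filter.atTop, m β < m₀ := by
  intro G _ _ _ _ hG r
  exact Theorems.rpProbeCriticality_proof G hG r
    (Theorems.EquipartitionPinsProbe_proof G hG r (Theorems.freeEnergyLogCoefficient_proof G hG r))

/-- The hub (DirichletWindow spelling, verbatim = EquipartitionCriticality.CriticalContinuumLimit) implies the crux,
criticality being a theorem. [folklore] -/
theorem latticeGapToClay_of_weakCouplingContinuumLimit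
    (hhub : Theses.DirichletWindow.WeakCouplingContinuumLimit) :
    Theses.RandomConstraintAnnealing.LatticeGapToClay := by
  intro hX G _ _ _ _ hG
  refine hhub G hG (fun r => ?_) (weakCouplingCriticality' G hG)
  obtain ⟨β₀, m, S₀, hm, hAB⟩ := hX G hG r
  refine ⟨β₀, m, S₀, hm, fun A B => ?_⟩
  obtain ⟨C, hC⟩ := hAB A B
  exact ⟨C, fun β hβ S n hS hn => hC β hβ S hS n hn⟩


/-- **The hub from its three birth-stub STATEMENTS** (verbatim copy of the sorry-free closed-proposition glue of
`Cruxes/WeakCouplingContinuumLimit/Lines/birth.lean`, registrar planner-skel-stmt-QuantumFields-15940-0; the stub statements are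
explicit hypotheses `h₁` saturation, `h₂` one-field OS continuum limit, `h₃` non-Gaussianity). [folklore] -/
theorem weakCouplingContinuumLimit_of_birthStubs
    (h₁ : ∀ {G : Type} [Group G] [TopologicalSpace G] [IsTopologicalGroup G] [CompactSpace G]
    [MeasurableSpace G] [BorelSpace G]
    (hG : IsCompactSimpleLieGroup G) (r : LatticeRep G)
    (β₁ : ℝ) (m : ℝ → ℝ) (S₀ : ℝ → ℕ) (hpos : ∀ β : ℝ, β₁ ≤ β → 0 < m β)
    (hdec : ∀ A B : YMSpecies G, ∃ C : ℝ, ∀ β : ℝ, β₁ ≤ β → ∀ S n : ℕ, S₀ β ≤ S → n ≤ S →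
        |latticeConnectedCorr r.ρ β (2 * S + 1) A.F B.F n| ≤ C * Real.exp (-(m β * n)))
    (H2 : ∀ (β₂ : ℝ) (m₂ : ℝ → ℝ), (∀ β : ℝ, β₂ ≤ β → 0 < m₂ β ∧ (∃ S₂ : ℕ, ∀ A B : YMSpecies G,
        ∃ C : ℝ, ∀ S n : ℕ, S₂ ≤ S → n ≤ S →
          |latticeConnectedCorr r.ρ β (2 * S + 1) A.F B.F n| ≤ C * Real.exp (-(m₂ β * n)))) →
        ∀ m₀ : ℝ, 0 < m₀ → ∀ᶠ β : ℝ in atTop, m₂ β < m₀),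
    ∃ (βs : ℝ) (ms : ℝ → ℝ) (Ss : ℝ → ℕ),
      (∀ β : ℝ, βs ≤ β → 0 < ms β) ∧
      (∀ A B : YMSpecies G, ∃ C : ℝ, ∀ β : ℝ, βs ≤ β → ∀ S n : ℕ, Ss β ≤ S → n ≤ S →
        |latticeConnectedCorr r.ρ β (2 * S + 1) A.F B.F n| ≤ C * Real.exp (-(ms β * n))) ∧
      ∃ C₀ : ℝ, 0 < C₀ ∧ ∃ᶠ β : ℝ in atTop, ∀ κ : ℝ, 0 < κ → ∃ w : ℝ, 0 < w ∧
        ∃ᶠ S : ℕ in atTop, ∀ n : ℕ, (n : ℝ) * ms β ≤ κ →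
          w * Real.exp (-(C₀ * (ms β * n))) ≤
            latticeConnectedCorr r.ρ β (2 * S + 1) (r.curvature.F ∘ gaugeTimeReflect) r.curvature.F n)
    (h₂ : ∀ {G : Type} [Group G] [TopologicalSpace G] [IsTopologicalGroup G] [CompactSpace G]
    [MeasurableSpace G] [BorelSpace G]
    (r : LatticeRep G) (βs : ℝ) (ms : ℝ → ℝ) (Ss : ℝ → ℕ)
    (hpos : ∀ β : ℝ, βs ≤ β → 0 < ms β)
    (hdec : ∀ A B : YMSpecies G, ∃ C : ℝ, ∀ β : ℝ, βs ≤ β → ∀ S n : ℕ, Ss β ≤ S → n ≤ S →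
        |latticeConnectedCorr r.ρ β (2 * S + 1) A.F B.F n| ≤ C * Real.exp (-(ms β * n)))
    (hcrit : ∀ m₀ : ℝ, 0 < m₀ → ∀ᶠ β : ℝ in atTop, ms β < m₀)
    (hP : ∃ C₀ : ℝ, 0 < C₀ ∧ ∃ᶠ β : ℝ in atTop, ∀ κ : ℝ, 0 < κ → ∃ w : ℝ, 0 < w ∧
        ∃ᶠ S : ℕ in atTop, ∀ n : ℕ, (n : ℝ) * ms β ≤ κ →
          w * Real.exp (-(C₀ * (ms β * n))) ≤
            latticeConnectedCorr r.ρ β (2 * S + 1) (r.curvature.F ∘ gaugeTimeReflect) r.curvature.F n),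
    ∃ (Δ : ℝ) (sch : SpeciesScheme (YMSpecies G)) (S₁ : SchwingerFamily (EuclideanSpace ℝ (Fin 4))),
      0 < Δ ∧ Tendsto sch.β atTop atTop ∧ (∀ᶠ k in atTop, βs ≤ sch.β k) ∧
      (∀ k, sch.a k = ms (sch.β k) / Δ) ∧ (∀ᶠ k in atTop, Ss (sch.β k) ≤ sch.L k) ∧
      OSAxiomsSchwinger S₁.toLabelled ∧
      (∀ (n : ℕ), n ≠ 0 → ∀ (f : Fin n → 𝓢(EuclideanSpace ℝ (Fin 4), ℝ))
        (F : 𝓢((Fin n → EuclideanSpace ℝ (Fin 4)), ℂ)),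
        IsTensorOf F (fun i => ofRealTest (f i)) → IsOffDiagonal F →
          Tendsto (fun k : ℕ =>
            ((latticeSchwinger r.ρ sch (fun s => s.F) k n (fun _ => r.curvature) f : ℝ) : ℂ))
            atTop (𝓝 (S₁ n F))) ∧
      (∃ (F₁ G₁ : 𝓢((Fin 1 → EuclideanSpace ℝ (Fin 4)), ℂ))
        (H₁ : 𝓢((Fin (1 + 1) → EuclideanSpace ℝ (Fin 4)), ℂ)),
        IsTimeOrdered F₁ ∧ IsTimeOrdered G₁ ∧ IsAppendTensorOf H₁ (osAdjoint F₁) G₁ ∧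
          S₁ (1 + 1) H₁ ≠ S₁ 1 (osAdjoint F₁) * S₁ 1 G₁) ∧
      S₁.toLabelled.HasMassGap Δ)
    (h₃ : ∀ {G : Type} [Group G] [TopologicalSpace G] [IsTopologicalGroup G] [CompactSpace G]
    [MeasurableSpace G] [BorelSpace G]
    (hG : IsCompactSimpleLieGroup G) (r : LatticeRep G)
    (βs : ℝ) (ms : ℝ → ℝ) (Ss : ℝ → ℕ) (hpos : ∀ β : ℝ, βs ≤ β → 0 < ms β)
    (hdec : ∀ A B : YMSpecies G, ∃ C : ℝ, ∀ β : ℝ, βs ≤ β → ∀ S n : ℕ, Ss β ≤ S → n ≤ S →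
        |latticeConnectedCorr r.ρ β (2 * S + 1) A.F B.F n| ≤ C * Real.exp (-(ms β * n)))
    (Δ : ℝ) (hΔ : 0 < Δ) (sch : SpeciesScheme (YMSpecies G))
    (hride : Tendsto sch.β atTop atTop ∧ (∀ᶠ k in atTop, βs ≤ sch.β k) ∧
      (∀ k, sch.a k = ms (sch.β k) / Δ) ∧ (∀ᶠ k in atTop, Ss (sch.β k) ≤ sch.L k))
    (S₁ : SchwingerFamily (EuclideanSpace ℝ (Fin 4))) (hOS : OSAxiomsSchwinger S₁.toLabelled)
    (hconv : ∀ (n : ℕ), n ≠ 0 → ∀ (f : Fin n → 𝓢(EuclideanSpace ℝ (Fin 4), ℝ))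
        (F : 𝓢((Fin n → EuclideanSpace ℝ (Fin 4)), ℂ)),
        IsTensorOf F (fun i => ofRealTest (f i)) → IsOffDiagonal F →
          Tendsto (fun k : ℕ =>
            ((latticeSchwinger r.ρ sch (fun s => s.F) k n (fun _ => r.curvature) f : ℝ) : ℂ))
            atTop (𝓝 (S₁ n F)))
    (hnt : ∃ (F₁ G₁ : 𝓢((Fin 1 → EuclideanSpace ℝ (Fin 4)), ℂ))
        (H₁ : 𝓢((Fin (1 + 1) → EuclideanSpace ℝ (Fin 4)), ℂ)),
        IsTimeOrdered F₁ ∧ IsTimeOrdered G₁ ∧ IsAppendTensorOf H₁ (osAdjoint F₁) G₁ ∧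
          S₁ (1 + 1) H₁ ≠ S₁ 1 (osAdjoint F₁) * S₁ 1 G₁)
    (hgap : S₁.toLabelled.HasMassGap Δ),
    ∃ (f g h : 𝓢(EuclideanSpace ℝ (Fin 4), ℂ)) (Ffgh : 𝓢((Fin 3 → EuclideanSpace ℝ (Fin 4)), ℂ))
        (Fgh Ffh Ffg : 𝓢((Fin 2 → EuclideanSpace ℝ (Fin 4)), ℂ))
        (Ff Fg Fh : 𝓢((Fin 1 → EuclideanSpace ℝ (Fin 4)), ℂ)),
        IsTensorOf Ffgh ![f, g, h] ∧ IsOffDiagonal Ffgh ∧ IsTensorOf Fgh ![g, h] ∧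
        IsTensorOf Ffh ![f, h] ∧ IsTensorOf Ffg ![f, g] ∧ IsTensorOf Ff ![f] ∧ IsTensorOf Fg ![g] ∧
        IsTensorOf Fh ![h] ∧
          S₁ 3 Ffgh - S₁ 1 Ff * S₁ 2 Fgh - S₁ 1 Fg * S₁ 2 Ffh - S₁ 1 Fh * S₁ 2 Ffg +
            2 * (S₁ 1 Ff * S₁ 1 Fg * S₁ 1 Fh) ≠ 0) :
    Summit.QuantumFields.YangMills.Theses.DirichletWindow.WeakCouplingContinuumLimit := by
  intro G _ _ _ _ hG H1 H2
  letI : MeasurableSpace G := borel G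
  haveI : BorelSpace G := ⟨rfl⟩
  -- a faithful representation (`IsCompactSimpleLieGroup` = simple ∧ linear)
  obtain ⟨r⟩ := hG.2
  -- H1 for `r`: one uniformly admissible rate
  obtain ⟨β₁, m, S₀, hpos, hdec⟩ := H1 r
  -- STUB 1 (lattice infrared): a uniformly admissible rate saturated by the plaquette
  obtain ⟨βs, ms, Ss, hpos', hdec', hP⟩ := h₁ hG r β₁ m S₀ hpos hdec (H2 r)
  -- H2: the saturated rate is admissible, hence critical
  have hcrit : ∀ m₀ : ℝ, 0 < m₀ → ∀ᶠ β : ℝ in atTop, ms β < m₀ := by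
    refine H2 r βs ms fun β hβ => ⟨hpos' β hβ, Ss β, fun A B => ?_⟩
    obtain ⟨C, hC⟩ := hdec' A B
    exact ⟨C, fun S n hS hn => hC β hβ S n hS hn⟩
  -- STUB 2 (continuum ultraviolet / OS leg): scheme riding `ms` at gap `Δ`, one OS field, alive, massive
  obtain ⟨Δ, sch, S₁, hΔ, hβtop, hβk, hak, hLk, hOS, hconv, hnt, hgap⟩ :=
    h₂ r βs ms Ss hpos' hdec' hcrit hP
  -- STUB 3 (interaction): that limit is not a generalised free field
  have hng := h₃ hG r βs ms Ss hpos' hdec' Δ hΔ sch ⟨hβtop, hβk, hak, hLk⟩ S₁ hOS hconv hnt hgap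
  -- LANDED glue (line `Sketch` of the predecessor crux 8762): all-species packaging by silencing,
  -- and the lattice clause re-indexed along the riding scheme
  obtain ⟨T, hYM, hT1, hT2, hT3⟩ :=
    Theorems.CriticalContinuumLimit.stub_oneFieldExtension r sch S₁ Δ hOS hconv hnt hng hgap
  have hlat : HasLatticeMassGap r (onlySpecies sch r.curvature) Δ :=
    Theorems.CriticalContinuumLimit.stub_latticeGap r βs ms Ss Δ hΔ hdec'
      (onlySpecies sch r.curvature) hβk hak hLk
  -- the new conjunct of the re-typed statement: `β_k → ∞` (silencing keeps `β`)
  have hw : (onlySpecies sch r.curvature).HasWeakCouplingLimit := hβtop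
  exact ⟨r, onlySpecies sch r.curvature, T, hw, hYM, hT1, hT2, Δ, hΔ, hT3, hlat⟩



/-! ## Identity with the hub's birth stubs (defeq, incl. the inlined `gaugeTimeReflect`) -/

-- (binder explicitness differs; `Iff.rfl` checks definitional equality, which ignores binder info)

/-- **VARIANT B assembly**: the three children imply the crux outright (criticality discharged in-tree). [folklore] -/
theorem latticeGapToClay_of_variantB (h1 : RateSaturation) (h2 : ContinuumLimitOS) (h3 : NonGaussianLimit) :
    Theses.RandomConstraintAnnealing.LatticeGapToClay :=
  latticeGapToClay_of_weakCouplingContinuumLimit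
    (weakCouplingContinuumLimit_of_birthStubs (fun {G} => h1 G) (fun {G} => h2 G) (fun {G} => h3 G))

end Summit.QuantumFields.YangMills.Cruxes.LatticeGapToClay.VariantB

end
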